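import Literature.NumberTheory.EllipticCurves.PAdicTwoVariableTransformCharacter
import Literature.NumberTheory.GaloisRepresentations.LocalOneUnitsProofs
import HarnessLib

/-!
# The INVERSE two-variable Amice transform: the bounded distribution on `ℤ_p²` of a power series
# with bounded coefficients in a complete non-archimedean field over `ℚ_p`

Companion of `PAdicTwoVariableTransformCharacter.lean` (the transform `D ↦ 𝓐_D` of a bounded
`𝕜`-valued distribution on `ℤ_p × ℤ_p` and its values at continuous characters). Here we go BACK: for
`G = Σ c_{kl} T₁^k T₂^l ∈ 𝕜⟦T₂⟧⟦T₁⟧` with `‖c_{kl}‖ ≤ C` we construct the bounded distribution `D_G`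
(`invAmice₂`) with

  `D_G(a + pⁿℤ_p, b + pⁿℤ_p) = Σ_{k,l} c_{kl} · e_k(n, a) · e_l(n, b)`,

where `e_k(n, a) = Δ^k[𝟙_{a + pⁿℤ_p}](0) ∈ ℤ_p` are the Mahler coefficients of the indicator of the
residue class (`cellMahlerCoeff`; they tend to `0` by Mahler's theorem, Mathlib
`PadicInt.fwdDiff_tendsto_zero`, so the series converges), prove that it is a distribution of norm
`≤ C` (`sum_fiber` from `𝟙_{a + pⁿ} = Σ_{a' ↦ a} 𝟙_{a' + pⁿ⁺¹}`), and prove the **inversion theorem**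

  `𝓐_{D_G} = G`      (`amice₂_invAmice₂`),

i.e. `∫ (x choose i)(y choose j) dD_G = c_{ij}`: the level-`N` Riemann sum is
`Σ_{k,l} c_{kl} A_k^N(i) A_l^N(j)` with `A_k^N(i) = Δ^k[s_N^i](0)` the Mahler coefficients of the
level-`N` step function `s_N^i` of `x ↦ (x choose i)`, `‖A_k^N(i) − δ_{ki}‖ ≤ ‖s_N^i − (· choose i)‖_∞ → 0`
(Mahler coefficients are `1`-Lipschitz for the sup norm), and the ultrametric inequality bounds the
whole tail at once. This is de Shalit 1987, I.3.1–3.3 ("a measure on `ℤ_p` with values in `𝐃` …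
`∫ (1+T)^x dμ` … conversely every power series arises from a unique measure") in two variables and
over any complete non-archimedean `𝕜 ⊇ ℚ_p` (`ℂ_p`), the dictionary by which a Coleman power series
becomes a measure (I.3.4–3.7) and by which the frame `IsKatzMeasure₂` (a power series) and the
integral form `DeShalit1987.IsKatzDistribution₂` (a distribution) of the two-variable Katz–de Shalit
`L`-function determine each other (`DeShalit1987/KatzMeasureFromDistribution.lean` and its sequel).

## Main definitions and results (all proved; no named fact)

* `cellIndicator n a : C(ℤ_[p], ℤ_[p])`, `cellMahlerCoeff n a k = Δ^k[𝟙_a](0)`: decay, bound `≤ 1`,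
  refinement relation `cellMahlerCoeff_eq_sum_fiber`.
* `levelRepr N : C(ℤ_[p], ℤ_[p])` (`x ↦ (x mod p^N).val`), `mahlerStep N i = (mahler i) ∘ levelRepr N`,
  `tendsto_norm_mahlerStep_sub` (`‖s_N^i − mahler i‖ → 0`), `fwdDiff_iter_mahler_zero`
  (`Δ^k[mahler i](0) = δ_{ki}`).
* `invAmiceMass p G n c`, `invAmice₂ p G hC` — the distribution of `G`.
* `riemannSum_invAmice₂_mahlerFun₂` — the Riemann sums of the binomial functions;
  `amice₂_invAmice₂` — **the inversion theorem** `𝓐_{D_G} = G`;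
  `hasSum_invAmice₂_character` — `G(F(1,0) − 1, F(0,1) − 1) = ∫ F dD_G` for every
  continuous character `F` of `ℤ_p²`.

## References

* [deShalit1987] E. de Shalit, *Iwasawa theory of elliptic curves with complex multiplication*,
  Perspectives in Math. 3 (1987), I.3.1–3.4 (p. 13–15), II.4.17 (53)–(54) (p. 77–78).
* [Washington1997] L. C. Washington, *Introduction to Cyclotomic Fields*, GTM 83, §12.2 (measures and
  power series, `Λ ≅ ℤ_p⟦ℤ_p⟧`), §7.2.
* [MazurTateTeitelbaum1986Invent] B. Mazur, J. Tate, J. Teitelbaum, Invent. Math. 84 (1986), §I.11.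
-/

noncomputable section

open Filter Topology
open scoped fwdDiff

namespace Literature.NumberTheory.EllipticCurves

variable {p : ℕ} [Fact p.Prime]

/-! ### §1. Indicators of residue classes and their Mahler coefficients -/

section Indicator

/-- **The indicator function of the residue class `a + pⁿℤ_p`**, as a continuous `ℤ_p`-valued function
on `ℤ_p` (locally constant: it factors through `ℤ_p → ℤ/pⁿ`). [cite: deShalit1987, I.3.1 (p. 13)] -/
def cellIndicator (n : ℕ) (a : ZMod (p ^ n)) : C(ℤ_[p], ℤ_[p]) where
  toFun x := if PadicInt.toZModPow n x = a then 1 else 0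
  continuous_toFun :=
    (continuous_of_discreteTopology (f := fun t : ZMod (p ^ n) ↦ if t = a then (1 : ℤ_[p]) else 0)).comp
      (Literature.NumberTheory.GaloisRepresentations.OneUnits.continuous_toZModPow p n)

/-- Unfolding lemma for `cellIndicator`. [cite: deShalit1987, I.3.1 (p. 13)] -/
theorem cellIndicator_apply (n : ℕ) (a : ZMod (p ^ n)) (x : ℤ_[p]) :
    cellIndicator n a x = if PadicInt.toZModPow n x = a then 1 else 0 := rfl

/-- The indicator takes values of norm `≤ 1`. [cite: deShalit1987, I.3.1 (p. 13)] -/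
theorem norm_cellIndicator_apply_le (n : ℕ) (a : ZMod (p ^ n)) (x : ℤ_[p]) :
    ‖cellIndicator n a x‖ ≤ 1 := by
  rw [cellIndicator_apply]
  split_ifs <;> simp

/-- The indicator has sup norm `≤ 1`. [cite: deShalit1987, I.3.1 (p. 13)] -/
theorem norm_cellIndicator_le (n : ℕ) (a : ZMod (p ^ n)) : ‖cellIndicator n a‖ ≤ 1 :=
  (ContinuousMap.norm_le _ zero_le_one).mpr (norm_cellIndicator_apply_le n a)

/-- **Refinement of indicators**: `𝟙_{a + pⁿℤ_p} = Σ_{a' ↦ a} 𝟙_{a' + pⁿ⁺¹ℤ_p}` (sum over the lifts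
of `a` to `ℤ/pⁿ⁺¹`), as functions on `ℤ_p`. [cite: deShalit1987, I.3.1 (p. 13)] -/
theorem coe_cellIndicator_eq_sum_fiber (n : ℕ) (a : ZMod (p ^ n)) :
    (⇑(cellIndicator n a) : ℤ_[p] → ℤ_[p]) =
      ∑ b ∈ Finset.univ.filter
        (fun b : ZMod (p ^ (n + 1)) ↦ ZMod.castHom (pow_dvd_pow p n.le_succ) (ZMod (p ^ n)) b = a),
        (⇑(cellIndicator (n + 1) b) : ℤ_[p] → ℤ_[p]) := by
  funext x
  rw [Finset.sum_apply]
  simp only [cellIndicator_apply]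
  have hcast : ZMod.castHom (pow_dvd_pow p n.le_succ) (ZMod (p ^ n)) (PadicInt.toZModPow (n + 1) x) =
      PadicInt.toZModPow n x := by
    rw [ZMod.castHom_apply, PadicInt.cast_toZModPow n (n + 1) n.le_succ]
  simp only [Finset.sum_ite_eq, Finset.mem_filter, Finset.mem_univ, true_and, hcast]

/-- **The Mahler coefficients of the indicator of a residue class**: `e_k(n, a) = Δ^k[𝟙_{a + pⁿℤ_p}](0)`,
an element of `ℤ_p` (an alternating binomial sum over the class). [cite: deShalit1987, I.3.1 (p. 13)] -/
def cellMahlerCoeff (n : ℕ) (a : ZMod (p ^ n)) (k : ℕ) : ℤ_[p] := Δ_[1] ^[k] (⇑(cellIndicator n a)) 0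

/-- **The Mahler coefficients of an indicator tend to `0`** (Mahler's theorem for the continuous
function `𝟙_{a + pⁿℤ_p}`, Mathlib `PadicInt.fwdDiff_tendsto_zero`). [cite: Washington1997, §12.2] -/
theorem tendsto_cellMahlerCoeff_zero (n : ℕ) (a : ZMod (p ^ n)) :
    Tendsto (cellMahlerCoeff n a) atTop (𝓝 0) := by
  unfold cellMahlerCoeff
  exact PadicInt.fwdDiff_tendsto_zero (cellIndicator n a)

/-- `‖e_k(n, a)‖ ≤ 1`. [cite: Washington1997, §12.2] -/
theorem norm_cellMahlerCoeff_le_one (n : ℕ) (a : ZMod (p ^ n)) (k : ℕ) : ‖cellMahlerCoeff n a k‖ ≤ 1 :=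
  (IsUltrametricDist.norm_fwdDiff_iter_apply_le 1 (cellIndicator n a) 0 k).trans (norm_cellIndicator_le n a)

/-- **Refinement of the Mahler coefficients**: `e_k(n, a) = Σ_{a' ↦ a} e_k(n+1, a')` (forward
differences are additive). [cite: deShalit1987, I.3.1 (p. 13)] -/
theorem cellMahlerCoeff_eq_sum_fiber (n : ℕ) (a : ZMod (p ^ n)) (k : ℕ) :
    cellMahlerCoeff n a k =
      ∑ b ∈ Finset.univ.filter
        (fun b : ZMod (p ^ (n + 1)) ↦ ZMod.castHom (pow_dvd_pow p n.le_succ) (ZMod (p ^ n)) b = a),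
        cellMahlerCoeff (n + 1) b k := by
  unfold cellMahlerCoeff
  rw [coe_cellIndicator_eq_sum_fiber, fwdDiff_iter_finsetSum, Finset.sum_apply]

end Indicator

/-! ### §2. Step functions of the binomials and their Mahler coefficients -/

section Step

/-- **The level-`N` representative map** `x ↦ (x mod p^N).val ∈ ℕ ⊂ ℤ_p` (the chosen point of the
level-`N` cell, `ProfiniteTower.padicInt`), as a continuous (locally constant) map.
[cite: MazurTateTeitelbaum1986Invent, §I.11] -/
def levelRepr (N : ℕ) : C(ℤ_[p], ℤ_[p]) where
  toFun x := ((PadicInt.toZModPow N x).val : ℤ_[p])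
  continuous_toFun :=
    (continuous_of_discreteTopology (f := fun t : ZMod (p ^ N) ↦ ((t.val : ℕ) : ℤ_[p]))).comp
      (Literature.NumberTheory.GaloisRepresentations.OneUnits.continuous_toZModPow p N)

/-- Unfolding lemma for `levelRepr`. [cite: MazurTateTeitelbaum1986Invent, §I.11] -/
theorem levelRepr_apply (N : ℕ) (x : ℤ_[p]) : levelRepr N x = ((PadicInt.toZModPow N x).val : ℤ_[p]) := rfl

/-- The representative lies in the cell: `(x mod p^N).val ≡ x (mod p^N)`. [cite: MazurTateTeitelbaum1986Invent, §I.11] -/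
theorem toZModPow_levelRepr (N : ℕ) (x : ℤ_[p]) :
    PadicInt.toZModPow N (levelRepr N x) = PadicInt.toZModPow N x := by
  haveI : NeZero (p ^ N) := ⟨pow_ne_zero _ (Fact.out : p.Prime).ne_zero⟩
  rw [levelRepr_apply, map_natCast, ZMod.natCast_zmod_val]

/-- **Cells shrink**: `‖x − (x mod p^N).val‖ ≤ p^{−N}`. [cite: MazurTateTeitelbaum1986Invent, §I.11] -/
theorem norm_sub_levelRepr_le (N : ℕ) (x : ℤ_[p]) : ‖x - levelRepr N x‖ ≤ (p : ℝ) ^ (-(N : ℤ)) := by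
  have hker : x - levelRepr N x ∈ RingHom.ker (PadicInt.toZModPow N : ℤ_[p] →+* ZMod (p ^ N)) := by
    rw [RingHom.mem_ker, map_sub, toZModPow_levelRepr, sub_self]
  rw [PadicInt.ker_toZModPow, ← PadicInt.norm_le_pow_iff_mem_span_pow] at hker
  exact hker

/-- **The level-`N` step function of `x ↦ (x choose i)`**: `s_N^i = (mahler i) ∘ levelRepr N`, i.e.
`x ↦ ((x mod p^N).val choose i)`. [cite: MazurTateTeitelbaum1986Invent, §I.11] -/
def mahlerStep (N i : ℕ) : C(ℤ_[p], ℤ_[p]) := (mahler i).comp (levelRepr N)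

/-- Unfolding lemma for `mahlerStep`. [cite: MazurTateTeitelbaum1986Invent, §I.11] -/
theorem mahlerStep_apply (N i : ℕ) (x : ℤ_[p]) :
    mahlerStep N i x = (((PadicInt.toZModPow N x).val.choose i : ℕ) : ℤ_[p]) := by
  rw [mahlerStep, ContinuousMap.comp_apply, levelRepr_apply, mahler_natCast_eq]

/-- The step function has sup norm `≤ 1`. [cite: MazurTateTeitelbaum1986Invent, §I.11] -/
theorem norm_mahlerStep_le (N i : ℕ) : ‖mahlerStep (p := p) N i‖ ≤ 1 :=
  (ContinuousMap.norm_le _ zero_le_one).mpr fun _ ↦ PadicInt.norm_le_one _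

/-- **The step functions converge uniformly to the binomial function**: `‖s_N^i − mahler i‖_∞ → 0`
(uniform continuity of `mahler i` on the compact `ℤ_p` and `‖x − (x mod p^N).val‖ ≤ p^{−N}`).
[cite: MazurTateTeitelbaum1986Invent, §I.11] -/
theorem tendsto_norm_mahlerStep_sub (i : ℕ) :
    Tendsto (fun N : ℕ ↦ ‖mahlerStep (p := p) N i - mahler i‖) atTop (𝓝 0) := by
  rw [Metric.tendsto_atTop]
  intro ε hε
  have huc : UniformContinuous (mahler (p := p) i) :=
    CompactSpace.uniformContinuous_of_continuous (mahler i).continuous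
  obtain ⟨δ, hδ, hδε⟩ := Metric.uniformContinuous_iff.mp huc (ε / 2) (half_pos hε)
  have hp1 : (1 : ℝ) < p := by exact_mod_cast (Fact.out : p.Prime).one_lt
  obtain ⟨N₀, hN₀⟩ := exists_pow_lt_of_lt_one hδ (inv_lt_one_of_one_lt₀ hp1)
  refine ⟨N₀, fun N hN ↦ ?_⟩
  rw [dist_zero_right, norm_norm]
  have hle : ‖mahlerStep (p := p) N i - mahler i‖ ≤ ε / 2 := by
    refine (ContinuousMap.norm_le _ (half_pos hε).le).mpr fun x ↦ ?_
    rw [ContinuousMap.sub_apply, mahlerStep, ContinuousMap.comp_apply]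
    have hd : dist (levelRepr N x) x < δ := by
      rw [dist_eq_norm, ← norm_neg, neg_sub]
      calc ‖x - levelRepr N x‖ ≤ (p : ℝ) ^ (-(N : ℤ)) := norm_sub_levelRepr_le N x
        _ ≤ (p : ℝ) ^ (-(N₀ : ℤ)) := zpow_le_zpow_right₀ hp1.le (by omega)
        _ = ((p : ℝ)⁻¹) ^ N₀ := by rw [zpow_neg, zpow_natCast, inv_pow]
        _ < δ := hN₀
    have := hδε hd
    rw [dist_eq_norm] at this
    exact this.le
  linarith

/-- **The Mahler coefficients of the Mahler basis**: `Δ^k[mahler i](0) = δ_{ki}` (the Mahler expansion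
of `mahler i` is itself). [cite: Washington1997, §12.2] -/
theorem fwdDiff_iter_mahler_zero (i k : ℕ) :
    Δ_[1] ^[k] (⇑(mahler (p := p) i)) 0 = if k = i then 1 else 0 := by
  have ha : Tendsto (fun n : ℕ ↦ (Pi.single i (1 : ℤ_[p]) : ℕ → ℤ_[p]) n) atTop (𝓝 0) := by
    apply tendsto_const_nhds.congr'
    filter_upwards [Filter.eventually_gt_atTop i] with n hn
    rw [Pi.single_eq_of_ne hn.ne']
  have hser : (PadicInt.mahlerSeries (p := p) (Pi.single i (1 : ℤ_[p])) : C(ℤ_[p], ℤ_[p])) = mahler i := by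
    rw [PadicInt.mahlerSeries, tsum_eq_single i]
    · rw [Pi.single_eq_same, PadicInt.mahlerTerm_one]
    · intro n hn
      rw [Pi.single_eq_of_ne hn]
      ext x
      simp [PadicInt.mahlerTerm_apply]
  have h := PadicInt.fwdDiff_mahlerSeries (p := p) ha k
  rw [hser] at h
  rw [h]
  by_cases hk : k = i
  · rw [hk, Pi.single_eq_same, if_pos rfl]
  · rw [Pi.single_eq_of_ne hk, if_neg hk]

/-- Forward differences at a point are additive-subtractive in the function (explicit-sum form).
[cite: Washington1997, §12.2] -/
theorem fwdDiff_iter_sub_apply {M G : Type*} [AddCommMonoid M] [AddCommGroup G] (h : M) (f g : M → G)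
    (n : ℕ) (y : M) : Δ_[h] ^[n] (f - g) y = Δ_[h] ^[n] f y - Δ_[h] ^[n] g y := by
  simp only [fwdDiff_iter_eq_sum_shift, Pi.sub_apply, smul_sub, Finset.sum_sub_distrib]

/-- **The Mahler coefficients of the step function are `δ_{ki}` up to `‖s_N^i − mahler i‖_∞`**:
`‖Δ^k[s_N^i](0) − δ_{ki}‖ ≤ ‖s_N^i − mahler i‖_∞` (Mahler coefficients are `1`-Lipschitz for the sup
norm, ultrametric). [cite: Washington1997, §12.2] -/
theorem norm_fwdDiff_iter_mahlerStep_sub_le (N i k : ℕ) :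
    ‖Δ_[1] ^[k] (⇑(mahlerStep (p := p) N i)) 0 - (if k = i then 1 else 0)‖ ≤ ‖mahlerStep (p := p) N i - mahler i‖ := by
  rw [← fwdDiff_iter_mahler_zero i k, ← fwdDiff_iter_sub_apply, ← ContinuousMap.coe_sub]
  exact IsUltrametricDist.norm_fwdDiff_iter_apply_le 1 _ 0 k

/-- The Mahler coefficients of the step function have norm `≤ 1`. [cite: Washington1997, §12.2] -/
theorem norm_fwdDiff_iter_mahlerStep_le (N i k : ℕ) : ‖Δ_[1] ^[k] (⇑(mahlerStep (p := p) N i)) 0‖ ≤ 1 :=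
  (IsUltrametricDist.norm_fwdDiff_iter_apply_le 1 _ 0 k).trans (norm_mahlerStep_le N i)

/-- **The step function as a combination of indicators**: `s_N^i = Σ_{a mod p^N} (a.val choose i)·𝟙_a`,
hence its Mahler coefficients are `Σ_a e_k(N, a)·(a.val choose i)`. [cite: MazurTateTeitelbaum1986Invent, §I.11] -/
theorem fwdDiff_iter_mahlerStep_eq_sum (N i k : ℕ) :
    Δ_[1] ^[k] (⇑(mahlerStep (p := p) N i)) 0 =
      ∑ a : ZMod (p ^ N), cellMahlerCoeff N a k * ((a.val.choose i : ℕ) : ℤ_[p]) := by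
  have hfun : (⇑(mahlerStep (p := p) N i) : ℤ_[p] → ℤ_[p]) =
      ∑ a : ZMod (p ^ N), ((a.val.choose i : ℕ) : ℤ_[p]) • (⇑(cellIndicator N a) : ℤ_[p] → ℤ_[p]) := by
    funext x
    rw [Finset.sum_apply, mahlerStep_apply]
    simp only [Pi.smul_apply, cellIndicator_apply, smul_eq_mul, mul_ite, mul_one, mul_zero]
    simp only [Finset.sum_ite_eq, Finset.mem_univ, if_true]
  rw [hfun, fwdDiff_iter_finsetSum, Finset.sum_apply]
  refine Finset.sum_congr rfl fun a _ ↦ ?_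
  rw [fwdDiff_iter_const_smul, Pi.smul_apply, smul_eq_mul, mul_comm]
  rfl

end Step

/-! ### §3. Summability of bounded-times-null double families -/

section Summable

variable {𝕜 : Type*} [NormedField 𝕜] [IsUltrametricDist 𝕜] [CompleteSpace 𝕜]

/-- **A bounded family times a product of two null sequences is summable over `ℕ × ℕ`** in a complete
non-archimedean field: `(k, l) ↦ c_{kl} · x_k · y_l` with `‖c‖ ≤ C`, `x_k → 0`, `y_l → 0` (the null
sequences are summable, their product family is summable — Mathlib `HasSum.mul_of_nonarchimedean` — hence
tends to `0` along the cofinite filter, and so does the bounded multiple). [cite: Washington1997, §12.2] -/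
theorem summable_mul_mul_of_tendsto_zero {c : ℕ × ℕ → 𝕜} {C : ℝ} (hc : ∀ kl, ‖c kl‖ ≤ C)
    {x y : ℕ → 𝕜} (hx : Tendsto x atTop (𝓝 0)) (hy : Tendsto y atTop (𝓝 0)) :
    Summable fun kl : ℕ × ℕ ↦ c kl * (x kl.1 * y kl.2) := by
  rw [← Nat.cofinite_eq_atTop] at hx hy
  have h0 : Tendsto (fun kl : ℕ × ℕ ↦ x kl.1 * y kl.2) cofinite (𝓝 0) :=
    tendsto_mul_cofinite_nhds_zero hx hy
  refine NonarchimedeanAddGroup.summable_of_tendsto_cofinite_zero ?_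
  rw [tendsto_zero_iff_norm_tendsto_zero] at h0 ⊢
  have hbound : ∀ kl : ℕ × ℕ, ‖c kl * (x kl.1 * y kl.2)‖ ≤ C * ‖x kl.1 * y kl.2‖ := fun kl ↦ by
    rw [norm_mul]; exact mul_le_mul_of_nonneg_right (hc kl) (norm_nonneg _)
  have hlim : Tendsto (fun kl : ℕ × ℕ ↦ C * ‖x kl.1 * y kl.2‖) cofinite (𝓝 0) := by
    simpa using h0.const_mul C
  exact squeeze_zero (fun _ ↦ norm_nonneg _) hbound hlim

omit [CompleteSpace 𝕜] in
/-- The sum of such a family is bounded by `C` when `‖x_k‖, ‖y_l‖ ≤ 1` (ultrametric bound for `tsum`).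
[cite: Washington1997, §12.2] -/
theorem norm_tsum_mul_mul_le {c : ℕ × ℕ → 𝕜} {C : ℝ} (hc : ∀ kl, ‖c kl‖ ≤ C)
    {x y : ℕ → 𝕜} (hx1 : ∀ k, ‖x k‖ ≤ 1) (hy1 : ∀ l, ‖y l‖ ≤ 1) :
    ‖∑' kl : ℕ × ℕ, c kl * (x kl.1 * y kl.2)‖ ≤ C := by
  have hC0 : 0 ≤ C := (norm_nonneg _).trans (hc (0, 0))
  refine IsUltrametricDist.norm_tsum_le_of_forall_le_of_nonneg hC0 fun kl ↦ ?_
  rw [norm_mul, norm_mul]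
  calc ‖c kl‖ * (‖x kl.1‖ * ‖y kl.2‖) ≤ C * (1 * 1) :=
        mul_le_mul (hc kl) (mul_le_mul (hx1 _) (hy1 _) (norm_nonneg _) zero_le_one)
          (mul_nonneg (norm_nonneg _) (norm_nonneg _)) hC0
    _ = C := by ring

end Summable

/-! ### §4. The distribution of a power series with bounded coefficients -/

section Inverse

variable {𝕜 : Type*} [NormedField 𝕜] [NormedAlgebra ℚ_[p] 𝕜] [IsUltrametricDist 𝕜] [CompleteSpace 𝕜]
variable (G : PowerSeries (PowerSeries 𝕜)) {C : ℝ}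

variable (p) in
/-- **The mass of the cell `(a + pⁿℤ_p) × (b + pⁿℤ_p)` under the distribution of `G`**:
`Σ_{k,l} [T₁^kT₂^l]G · e_k(n, a) · e_l(n, b)` (a convergent series: `e_k → 0`). For `G = 𝓐_D` this is
`∫ 𝟙_a(x)𝟙_b(y) dD` computed through the Mahler expansions of the indicators.
[cite: deShalit1987, I.3.1–3.3 (p. 13–14)] -/
def invAmiceMass (n : ℕ) (c : ZMod (p ^ n) × ZMod (p ^ n)) : 𝕜 :=
  ∑' kl : ℕ × ℕ, PowerSeries.coeff kl.2 (PowerSeries.coeff kl.1 G) *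
    (padicIntCast 𝕜 (cellMahlerCoeff n c.1 kl.1) * padicIntCast 𝕜 (cellMahlerCoeff n c.2 kl.2))

variable {G}

/-- The defining series of `invAmiceMass` is summable when the coefficients of `G` are bounded.
[cite: deShalit1987, I.3.1–3.3 (p. 13–14)] -/
theorem summable_invAmiceMass (hC : ∀ i j, ‖PowerSeries.coeff j (PowerSeries.coeff i G)‖ ≤ C) (n : ℕ)
    (c : ZMod (p ^ n) × ZMod (p ^ n)) :
    Summable fun kl : ℕ × ℕ ↦ PowerSeries.coeff kl.2 (PowerSeries.coeff kl.1 G) *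
      (padicIntCast 𝕜 (cellMahlerCoeff n c.1 kl.1) * padicIntCast 𝕜 (cellMahlerCoeff n c.2 kl.2)) := by
  refine summable_mul_mul_of_tendsto_zero (c := fun kl : ℕ × ℕ ↦
    PowerSeries.coeff kl.2 (PowerSeries.coeff kl.1 G))
    (x := fun k ↦ padicIntCast 𝕜 (cellMahlerCoeff n c.1 k))
    (y := fun l ↦ padicIntCast 𝕜 (cellMahlerCoeff n c.2 l)) (fun kl ↦ hC kl.1 kl.2) ?_ ?_
  · have h := ((continuous_padicIntCast (𝕜 := 𝕜)).tendsto 0).comp (tendsto_cellMahlerCoeff_zero n c.1)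
    rwa [Function.comp_def, map_zero] at h
  · have h := ((continuous_padicIntCast (𝕜 := 𝕜)).tendsto 0).comp (tendsto_cellMahlerCoeff_zero n c.2)
    rwa [Function.comp_def, map_zero] at h

omit [CompleteSpace 𝕜] in
/-- `‖invAmiceMass p G n c‖ ≤ C`. [cite: deShalit1987, I.3.1–3.3 (p. 13–14)] -/
theorem norm_invAmiceMass_le (hC : ∀ i j, ‖PowerSeries.coeff j (PowerSeries.coeff i G)‖ ≤ C) (n : ℕ)
    (c : ZMod (p ^ n) × ZMod (p ^ n)) : ‖invAmiceMass p G n c‖ ≤ C :=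
  norm_tsum_mul_mul_le (c := fun kl : ℕ × ℕ ↦ PowerSeries.coeff kl.2 (PowerSeries.coeff kl.1 G))
    (x := fun k ↦ padicIntCast 𝕜 (cellMahlerCoeff n c.1 k))
    (y := fun l ↦ padicIntCast 𝕜 (cellMahlerCoeff n c.2 l)) (fun kl ↦ hC kl.1 kl.2)
    (fun k ↦ by rw [norm_padicIntCast]; exact norm_cellMahlerCoeff_le_one n c.1 k)
    (fun l ↦ by rw [norm_padicIntCast]; exact norm_cellMahlerCoeff_le_one n c.2 l)

/-- The fibre of the product tower `ℤ_p² = lim (ℤ/pⁿ)²` over a cell is the product of the fibres.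
[cite: MazurTateTeitelbaum1986Invent, §I.11] -/
theorem filter_trans_padicIntSq_eq (n : ℕ) (c : ZMod (p ^ n) × ZMod (p ^ n)) :
    Finset.univ.filter (fun b : ZMod (p ^ (n + 1)) × ZMod (p ^ (n + 1)) ↦ (padicIntSq p).trans n b = c) =
      Finset.univ.filter (fun b : ZMod (p ^ (n + 1)) ↦
          ZMod.castHom (pow_dvd_pow p n.le_succ) (ZMod (p ^ n)) b = c.1) ×ˢ
        Finset.univ.filter (fun b : ZMod (p ^ (n + 1)) ↦
          ZMod.castHom (pow_dvd_pow p n.le_succ) (ZMod (p ^ n)) b = c.2) := by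
  ext b
  simp only [Finset.mem_filter, Finset.mem_univ, true_and, Finset.mem_product]
  change ((ProfiniteTower.padicInt p).trans n b.1, (ProfiniteTower.padicInt p).trans n b.2) = c ↔ _
  rw [ProfiniteTower.padicInt_trans, ProfiniteTower.padicInt_trans, Prod.ext_iff]
  exact Iff.rfl

/-- **The distribution relation for `invAmiceMass`**: the masses of the `p²` sub-cells of a cell add up
to the mass of the cell (from the refinement of the indicators' Mahler coefficients,
`cellMahlerCoeff_eq_sum_fiber`, summed inside the convergent series).
[cite: deShalit1987, I.3.1–3.3 (p. 13–14)] -/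
theorem sum_fiber_invAmiceMass (hC : ∀ i j, ‖PowerSeries.coeff j (PowerSeries.coeff i G)‖ ≤ C) (n : ℕ)
    (c : ZMod (p ^ n) × ZMod (p ^ n)) :
    ∑ b ∈ Finset.univ.filter
        (fun b : ZMod (p ^ (n + 1)) × ZMod (p ^ (n + 1)) ↦ (padicIntSq p).trans n b = c),
      invAmiceMass p G (n + 1) b = invAmiceMass p G n c := by
  rw [filter_trans_padicIntSq_eq]
  unfold invAmiceMass
  rw [← Summable.tsum_finsetSum (fun b _ ↦ summable_invAmiceMass hC (n + 1) b)]
  refine tsum_congr fun kl ↦ ?_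
  rw [← Finset.mul_sum, Finset.sum_product, cellMahlerCoeff_eq_sum_fiber n c.1 kl.1,
    cellMahlerCoeff_eq_sum_fiber n c.2 kl.2, map_sum, map_sum, Finset.sum_mul_sum]

variable (p) in
/-- **The bounded distribution `D_G` on `ℤ_p × ℤ_p` of a power series `G ∈ 𝕜⟦T₂⟧⟦T₁⟧` with coefficients
bounded by `C`** — the inverse two-variable Amice transform (de Shalit I.3.3: "every power series …
arises from a unique measure"): cell masses `invAmiceMass p G`, bound `C`.
[cite: deShalit1987, I.3.1–3.3 (p. 13–14)] -/
def invAmice₂ (G : PowerSeries (PowerSeries 𝕜))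
    (hC : ∀ i j, ‖PowerSeries.coeff j (PowerSeries.coeff i G)‖ ≤ C) :
    BoundedDistribution (padicIntSq p) 𝕜 where
  μ n c := invAmiceMass p G n c
  sum_fiber n c := sum_fiber_invAmiceMass hC n c
  bound := C
  bound_nonneg := (norm_nonneg _).trans (hC 0 0)
  norm_le n c := norm_invAmiceMass_le hC n c

/-- The level data of `D_G` are the cell masses. [cite: deShalit1987, I.3.1–3.3 (p. 13–14)] -/
@[simp] theorem invAmice₂_μ (hC : ∀ i j, ‖PowerSeries.coeff j (PowerSeries.coeff i G)‖ ≤ C)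
    (n : ℕ) (c : ZMod (p ^ n) × ZMod (p ^ n)) : (invAmice₂ p G hC).μ n c = invAmiceMass p G n c := rfl

/-- The bound of `D_G` is `C`. [cite: deShalit1987, I.3.1–3.3 (p. 13–14)] -/
@[simp] theorem invAmice₂_bound (hC : ∀ i j, ‖PowerSeries.coeff j (PowerSeries.coeff i G)‖ ≤ C) :
    (invAmice₂ p G hC).bound = C := rfl

/-! ### §5. The inversion theorem `𝓐_{D_G} = G` -/

/-- **The Riemann sums of the binomial functions against `D_G`**: at level `N`,
`RS_N((x choose i)(y choose j)) = Σ_{k,l} c_{kl} · A_k^N(i) · A_l^N(j)` with `A_k^N(i) = Δ^k[s_N^i](0)` the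
Mahler coefficients of the level-`N` step function of `x ↦ (x choose i)`.
[cite: deShalit1987, I.3.1–3.3 (p. 13–14)] -/
theorem riemannSum_invAmice₂_mahlerFun₂
    (hC : ∀ i j, ‖PowerSeries.coeff j (PowerSeries.coeff i G)‖ ≤ C) (i j N : ℕ) :
    (invAmice₂ p G hC).riemannSum (mahlerFun₂ 𝕜 i j) N =
      ∑' kl : ℕ × ℕ, PowerSeries.coeff kl.2 (PowerSeries.coeff kl.1 G) *
        (padicIntCast 𝕜 (Δ_[1] ^[kl.1] (⇑(mahlerStep (p := p) N i)) 0) *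
          padicIntCast 𝕜 (Δ_[1] ^[kl.2] (⇑(mahlerStep (p := p) N j)) 0)) := by
  rw [BoundedDistribution.riemannSum_def]
  -- unfold the cells and representatives of the product tower
  change ∑ c : ZMod (p ^ N) × ZMod (p ^ N), invAmiceMass p G N c *
      mahlerFun₂ 𝕜 i j (((c.1.val : ℕ) : ℤ_[p]), ((c.2.val : ℕ) : ℤ_[p])) = _
  simp_rw [mahlerFun₂_natCast]
  unfold invAmiceMass
  simp_rw [← tsum_mul_right]
  rw [← Summable.tsum_finsetSum (fun c _ ↦ (summable_invAmiceMass hC N c).mul_right _)]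
  refine tsum_congr fun kl ↦ ?_
  simp_rw [mul_assoc, ← Finset.mul_sum]
  congr 1
  rw [fwdDiff_iter_mahlerStep_eq_sum, fwdDiff_iter_mahlerStep_eq_sum, map_sum, map_sum,
    Finset.sum_mul_sum, ← Finset.univ_product_univ, Finset.sum_product]
  refine Finset.sum_congr rfl fun a _ ↦ Finset.sum_congr rfl fun b _ ↦ ?_
  rw [map_mul, map_mul, padicIntCast_natCast, padicIntCast_natCast]
  ring

/-- **The Riemann sums converge to the coefficient**: `‖RS_N − c_{ij}‖ ≤ C · max(‖s_N^i − mahler i‖,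
‖s_N^j − mahler j‖)` — subtract `c_{ij} = Σ_{k,l} c_{kl} δ_{ki} δ_{lj}` inside the series and bound every
term by the ultrametric inequality. [cite: deShalit1987, I.3.1–3.3 (p. 13–14)] -/
theorem norm_riemannSum_invAmice₂_sub_coeff_le
    (hC : ∀ i j, ‖PowerSeries.coeff j (PowerSeries.coeff i G)‖ ≤ C) (i j N : ℕ) :
    ‖(invAmice₂ p G hC).riemannSum (mahlerFun₂ 𝕜 i j) N - PowerSeries.coeff j (PowerSeries.coeff i G)‖ ≤
      C * max ‖mahlerStep (p := p) N i - mahler i‖ ‖mahlerStep (p := p) N j - mahler j‖ := by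
  have hC0 : 0 ≤ C := (norm_nonneg _).trans (hC 0 0)
  set A : ℕ → 𝕜 := fun k ↦ padicIntCast 𝕜 (Δ_[1] ^[k] (⇑(mahlerStep (p := p) N i)) 0) with hA
  set B : ℕ → 𝕜 := fun l ↦ padicIntCast 𝕜 (Δ_[1] ^[l] (⇑(mahlerStep (p := p) N j)) 0) with hB
  set dA : ℕ → 𝕜 := fun k ↦ if k = i then 1 else 0 with hdA
  set dB : ℕ → 𝕜 := fun l ↦ if l = j then 1 else 0 with hdB
  set ε := max ‖mahlerStep (p := p) N i - mahler i‖ ‖mahlerStep (p := p) N j - mahler j‖ with hε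
  -- the Riemann sum and the coefficient as sums of the same shape
  have hRS : (invAmice₂ p G hC).riemannSum (mahlerFun₂ 𝕜 i j) N =
      ∑' kl : ℕ × ℕ, PowerSeries.coeff kl.2 (PowerSeries.coeff kl.1 G) * (A kl.1 * B kl.2) :=
    riemannSum_invAmice₂_mahlerFun₂ hC i j N
  have hcoef : PowerSeries.coeff j (PowerSeries.coeff i G) =
      ∑' kl : ℕ × ℕ, PowerSeries.coeff kl.2 (PowerSeries.coeff kl.1 G) * (dA kl.1 * dB kl.2) := by
    rw [tsum_eq_single (i, j)]
    · simp [hdA, hdB]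
    · rintro ⟨k, l⟩ hkl
      have : ¬ (k = i ∧ l = j) := fun h ↦ hkl (Prod.ext h.1 h.2)
      simp only [hdA, hdB, mul_ite, mul_one, mul_zero]
      split_ifs with h1 h2 <;> simp_all
  -- summability of both families
  have hsA : Summable fun kl : ℕ × ℕ ↦ PowerSeries.coeff kl.2 (PowerSeries.coeff kl.1 G) * (A kl.1 * B kl.2) := by
    refine summable_mul_mul_of_tendsto_zero (c := fun kl : ℕ × ℕ ↦
      PowerSeries.coeff kl.2 (PowerSeries.coeff kl.1 G)) (x := A) (y := B) (fun kl ↦ hC kl.1 kl.2) ?_ ?_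
    · have h := ((continuous_padicIntCast (𝕜 := 𝕜)).tendsto 0).comp
        (PadicInt.fwdDiff_tendsto_zero (mahlerStep (p := p) N i))
      rw [map_zero] at h
      exact h
    · have h := ((continuous_padicIntCast (𝕜 := 𝕜)).tendsto 0).comp
        (PadicInt.fwdDiff_tendsto_zero (mahlerStep (p := p) N j))
      rw [map_zero] at h
      exact h
  have hsd : Summable fun kl : ℕ × ℕ ↦ PowerSeries.coeff kl.2 (PowerSeries.coeff kl.1 G) * (dA kl.1 * dB kl.2) := by
    refine summable_mul_mul_of_tendsto_zero (c := fun kl : ℕ × ℕ ↦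
      PowerSeries.coeff kl.2 (PowerSeries.coeff kl.1 G)) (x := dA) (y := dB) (fun kl ↦ hC kl.1 kl.2) ?_ ?_
    · apply tendsto_const_nhds.congr'
      filter_upwards [Filter.eventually_gt_atTop i] with n hn
      rw [hdA]; simp [hn.ne']
    · apply tendsto_const_nhds.congr'
      filter_upwards [Filter.eventually_gt_atTop j] with n hn
      rw [hdB]; simp [hn.ne']
  rw [hRS, hcoef, ← Summable.tsum_sub hsA hsd]
  refine IsUltrametricDist.norm_tsum_le_of_forall_le_of_nonneg (mul_nonneg hC0 (le_max_of_le_left (norm_nonneg _)))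
    fun kl ↦ ?_
  -- termwise bound
  have hA1 : ∀ k, ‖A k‖ ≤ 1 := fun k ↦ by
    rw [hA, norm_padicIntCast]; exact norm_fwdDiff_iter_mahlerStep_le N i k
  have hdB1 : ∀ l, ‖dB l‖ ≤ 1 := fun l ↦ by
    rw [hdB]; dsimp only; split_ifs <;> simp
  have hAd : ∀ k, ‖A k - dA k‖ ≤ ε := fun k ↦ by
    have : A k - dA k = padicIntCast 𝕜 (Δ_[1] ^[k] (⇑(mahlerStep (p := p) N i)) 0 - (if k = i then 1 else 0)) := by
      rw [hA, hdA, map_sub]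
      dsimp only
      split_ifs <;> simp
    rw [this, norm_padicIntCast]
    exact (norm_fwdDiff_iter_mahlerStep_sub_le N i k).trans (le_max_left _ _)
  have hBd : ∀ l, ‖B l - dB l‖ ≤ ε := fun l ↦ by
    have : B l - dB l = padicIntCast 𝕜 (Δ_[1] ^[l] (⇑(mahlerStep (p := p) N j)) 0 - (if l = j then 1 else 0)) := by
      rw [hB, hdB, map_sub]
      dsimp only
      split_ifs <;> simp
    rw [this, norm_padicIntCast]
    exact (norm_fwdDiff_iter_mahlerStep_sub_le N j l).trans (le_max_right _ _)
  have hε0 : 0 ≤ ε := le_max_of_le_left (norm_nonneg _)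
  rw [← mul_sub, norm_mul]
  have hsplit : A kl.1 * B kl.2 - dA kl.1 * dB kl.2 =
      (A kl.1 - dA kl.1) * B kl.2 + dA kl.1 * (B kl.2 - dB kl.2) := by ring
  have hdA1 : ‖dA kl.1‖ ≤ 1 := by rw [hdA]; dsimp only; split_ifs <;> simp
  have hB1 : ‖B kl.2‖ ≤ 1 := by
    rw [hB, norm_padicIntCast]; exact norm_fwdDiff_iter_mahlerStep_le N j kl.2
  have hdiff : ‖A kl.1 * B kl.2 - dA kl.1 * dB kl.2‖ ≤ ε := by
    rw [hsplit]
    refine (IsUltrametricDist.norm_add_le_max _ _).trans (max_le ?_ ?_)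
    · rw [norm_mul]
      calc ‖A kl.1 - dA kl.1‖ * ‖B kl.2‖ ≤ ε * 1 :=
            mul_le_mul (hAd _) hB1 (norm_nonneg _) hε0
        _ = ε := mul_one ε
    · rw [norm_mul]
      calc ‖dA kl.1‖ * ‖B kl.2 - dB kl.2‖ ≤ 1 * ε :=
            mul_le_mul hdA1 (hBd _) (norm_nonneg _) zero_le_one
        _ = ε := one_mul ε
  exact mul_le_mul (hC kl.1 kl.2) hdiff (norm_nonneg _) hC0

/-- **The inversion theorem, coefficientwise**: `∫ (x choose i)(y choose j) dD_G = [T₁^iT₂^j]G` — the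
Riemann sums converge to the integral (`tendsto_riemannSum_integral`) and to the coefficient
(`norm_riemannSum_invAmice₂_sub_coeff_le` with `‖s_N − mahler‖ → 0`).
[cite: deShalit1987, I.3.3 (p. 14)] -/
theorem integral_invAmice₂_mahlerFun₂
    (hC : ∀ i j, ‖PowerSeries.coeff j (PowerSeries.coeff i G)‖ ≤ C) (i j : ℕ) :
    (invAmice₂ p G hC).integral (mahlerFun₂ 𝕜 i j) = PowerSeries.coeff j (PowerSeries.coeff i G) := by
  have h1 : Tendsto ((invAmice₂ p G hC).riemannSum (mahlerFun₂ 𝕜 i j)) atTop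
      (𝓝 ((invAmice₂ p G hC).integral (mahlerFun₂ 𝕜 i j))) :=
    (invAmice₂ p G hC).tendsto_riemannSum_integral (uniformContinuous_mahlerFun₂ i j)
  have h2 : Tendsto ((invAmice₂ p G hC).riemannSum (mahlerFun₂ 𝕜 i j)) atTop
      (𝓝 (PowerSeries.coeff j (PowerSeries.coeff i G))) := by
    have hC0 : 0 ≤ C := (norm_nonneg _).trans (hC 0 0)
    have hε : Tendsto (fun N : ℕ ↦ C * max ‖mahlerStep (p := p) N i - mahler i‖
        ‖mahlerStep (p := p) N j - mahler j‖) atTop (𝓝 0) := by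
      have h := ((tendsto_norm_mahlerStep_sub (p := p) i).max (tendsto_norm_mahlerStep_sub (p := p) j)).const_mul C
      rwa [max_self, mul_zero] at h
    exact tendsto_iff_norm_sub_tendsto_zero.mpr
      (squeeze_zero (fun _ ↦ norm_nonneg _) (fun N ↦ norm_riemannSum_invAmice₂_sub_coeff_le hC i j N) hε)
  exact tendsto_nhds_unique h1 h2

/-- **THE INVERSION THEOREM `𝓐_{D_G} = G`**: the two-variable Amice transform of the distribution of a
power series with bounded coefficients is that power series (de Shalit I.3.3: power series and
measures determine each other). [cite: deShalit1987, I.3.3 (p. 14)] -/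
theorem amice₂_invAmice₂ (hC : ∀ i j, ‖PowerSeries.coeff j (PowerSeries.coeff i G)‖ ≤ C) :
    (invAmice₂ p G hC).amice₂ = G := by
  ext i j
  rw [BoundedDistribution.coeff_coeff_amice₂, integral_invAmice₂_mahlerFun₂]

/-- **The values of `G` at characters are integrals against `D_G`**: for every continuous character
`F` of `ℤ_p²` with principal-unit values at the basis,
`Σ_{k,l} [T₁^kT₂^l]G · (F(1,0) − 1)^k (F(0,1) − 1)^l = ∫ F dD_G` — "`G(χ(γ₁) − 1, χ(γ₂) − 1) = ∫ χ dμ_G`", de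
Shalit's (52)–(54) for the measure attached to `G`. [cite: deShalit1987, I.3.3 (p. 14), II.4.17 (52)–(54) (p. 77–78)] -/
theorem hasSum_invAmice₂_character (hC : ∀ i j, ‖PowerSeries.coeff j (PowerSeries.coeff i G)‖ ≤ C)
    {F : ℤ_[p] × ℤ_[p] → 𝕜} (hF : IsContinuousChar₂ F) :
    HasSum (fun kl : ℕ × ℕ ↦
      PowerSeries.coeff kl.2 (PowerSeries.coeff kl.1 G) * (F (1, 0) - 1) ^ kl.1 * (F (0, 1) - 1) ^ kl.2)
      ((invAmice₂ p G hC).integral F) := by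
  have h := (invAmice₂ p G hC).hasSum_amice₂_character hF
  rwa [amice₂_invAmice₂] at h

/-- **The total mass of `D_G` is the constant term of `G`**. [cite: deShalit1987, I.3.3 (p. 14)] -/
theorem integral_one_invAmice₂ (hC : ∀ i j, ‖PowerSeries.coeff j (PowerSeries.coeff i G)‖ ≤ C) :
    (invAmice₂ p G hC).integral (fun _ ↦ (1 : 𝕜)) =
      PowerSeries.constantCoeff (PowerSeries.constantCoeff G) := by
  rw [← BoundedDistribution.constantCoeff_constantCoeff_amice₂, amice₂_invAmice₂]

end Inverse

end Literature.NumberTheory.EllipticCurves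

end
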